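import Literature.NumberTheory.LFunctions.BurnolAdelicCausality
import Mathlib.Analysis.Calculus.MeanValue
import Mathlib.Analysis.Calculus.ContDiff.Deriv
import Mathlib.Analysis.SpecialFunctions.ImproperIntegrals
import Mathlib.Analysis.SpecialFunctions.Integrability.Basic
import Mathlib.MeasureTheory.Integral.DominatedConvergence
import Mathlib.MeasureTheory.Constructions.BorelSpace.Metrizable
import HarnessLib

/-!
# Proof of Burnol 2001, Thm 2.7 (inclusion clause): `V E(𝒮_{≤1}) ⊂ ℍ²`

LABEL (line 1): RH-FREE discharge of the named fact `Burnol2001_thm_2_7_subset` of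
`BurnolAdelicCausality.lean`. bears_on: LADDER-RH B-C/B-P (COLUMN 6 DBR). WHAT THIS IS NOT: an
elementary support-and-square-integrability statement about Burnol's functions `V E(φ)`; nothing
here bears on the truth of RH.

Source: J.-F. Burnol, *An adelic causality problem related to abelian L-functions*, J. Number
Theory 87 (2001) 253–269 = arXiv:math/0001013v3 [Burnol2001], §2, the paragraph before Thm 2.7
(TeX l.465–496): for `φ` smooth, even, supported in `[−1, 1]`, `E(φ)(u) = Σ_{n≥1} φ(nu) − (∫_0^∞ φ)/u`
"is `O(1)` when `u → 0` and is `O(1/u)` when `u → ∞` and belongs to `L²(ℝ₊, du)`"; `V·(1/u) = 0`;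
"for `φ ∈ 𝒮_{≤1}`, `VE(φ)` has support in `(0,1]`".

## Proof followed

Write `c = ∫_0^∞ φ` and `S(u) = Σ_{n≥1} φ(nu)` (a finite sum: `φ(nu) = 0` once `nu > 1`).
* Support: for `u > 1`, `S(u) = 0`, so `E(φ)(u) = −c/u`, and
  `V E(φ)(u) = −c/u − ∫_u^∞ (−c/v) dv/v = −c/u + c/u = 0`.
* Boundedness near `0` (Burnol's "`O(1)` when `u → 0`", here by the Riemann-sum estimate instead
  of Poisson summation): `u S(u) − c = Σ_n ∫_{(n−1)u}^{nu} (φ(nu) − φ(x)) dx`, and `φ` is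
  `L`-Lipschitz (`L = sup |φ′|`), so `|u S(u) − c| ≤ L u² (1/u + 1) ≤ 2 L u` for `u ≤ 1`, i.e.
  `|E(φ)(u)| ≤ 2L` on `(0,1]`.
* Hence for `u ∈ (0,1]`: `|V E(φ)(u)| ≤ |E(φ)(u)| + |∫_u^1 E(φ)(v) dv/v| + |∫_1^∞ c dv/v²|
  `≤ 2L + 2L·log(1/u) + |c|`, which is square-integrable on `(0,1]` (we dominate `log(1/u)` by
  `4 u^{−1/4}`), while `V E(φ) = 0` on `(1,∞)`; measurability from continuity on `(0,1)`.

## Main result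
* `Burnol2001_thm_2_7_subset_holds : Burnol2001_thm_2_7_subset`.
-/

noncomputable section

open Complex Set MeasureTheory Filter
open scoped ContDiff Topology

namespace Literature.NumberTheory.LFunctions

namespace Burnol2001

namespace IsTest

variable {φ : ℝ → ℂ}

/-! ## Elementary properties of a test function `φ ∈ 𝒮_{≤1}` -/

/-- A test function vanishes at every `x` with `1 < |x|`. [cite: Burnol2001, §2 (before Thm 2.7)] -/
theorem eq_zero_of_one_lt (hφ : IsTest φ) {x : ℝ} (hx : 1 < x) : φ x = 0 := by
  by_contra h
  have hmem := hφ.2.2 (Function.mem_support.2 h)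
  exact absurd hmem.2 (not_le.2 hx)

/-- A test function is continuous. [cite: Burnol2001, §2 (before Thm 2.7)] -/
theorem continuous (hφ : IsTest φ) : Continuous φ := hφ.1.continuous

/-- A test function is differentiable. [cite: Burnol2001, §2 (before Thm 2.7)] -/
theorem differentiable (hφ : IsTest φ) : Differentiable ℝ φ :=
  hφ.1.differentiable (by simp)

/-- The derivative of a test function vanishes on `(1, ∞)`. [cite: Burnol2001, §2 (before Thm 2.7)] -/
theorem deriv_eq_zero_of_one_lt (hφ : IsTest φ) {x : ℝ} (hx : 1 < x) : deriv φ x = 0 := by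
  have h : φ =ᶠ[𝓝 x] fun _ ↦ (0 : ℂ) := by
    filter_upwards [Ioi_mem_nhds hx] with y hy using hφ.eq_zero_of_one_lt hy
  rw [h.deriv_eq, deriv_const]

/-- A test function is Lipschitz on `[0, ∞)`: there is `L ≥ 0` with `‖φ y − φ x‖ ≤ L |y − x|` for
`x, y ≥ 0` (`L = sup |φ′|`, finite since `φ′` is continuous and vanishes on `(1,∞)`).
[cite: Burnol2001, §2 (before Thm 2.7)] -/
theorem exists_lipschitz (hφ : IsTest φ) :
    ∃ L : ℝ, 0 ≤ L ∧ ∀ x y : ℝ, 0 ≤ x → 0 ≤ y → ‖φ y - φ x‖ ≤ L * |y - x| := by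
  have hcont : Continuous (deriv φ) := hφ.1.continuous_deriv (by simp)
  obtain ⟨L, hL⟩ := (isCompact_Icc (a := (0 : ℝ)) (b := 2)).exists_bound_of_continuousOn
    hcont.continuousOn
  have hL0 : 0 ≤ L := (norm_nonneg _).trans (hL 0 (by simp))
  refine ⟨L, hL0, fun x y hx hy ↦ ?_⟩
  have hbound : ∀ z ∈ Ici (0 : ℝ), ‖deriv φ z‖ ≤ L := by
    intro z hz
    by_cases hz2 : z ≤ 2
    · exact hL z ⟨hz, hz2⟩
    · rw [hφ.deriv_eq_zero_of_one_lt (by linarith), norm_zero]; exact hL0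
  have := (convex_Ici (0 : ℝ)).norm_image_sub_le_of_norm_deriv_le
    (fun z _ ↦ hφ.differentiable.differentiableAt) hbound hx hy
  simpa [Real.norm_eq_abs] using this

/-! ## The periodic sum `S(u) = Σ_{n≥1} φ(nu)` is a finite sum -/

/-- For `u > 0` and `M ≥ 1/u`, the terms `φ((n+1)u)` with `n ≥ M` vanish.
[cite: Burnol2001, §2 (before Thm 2.7)] -/
theorem term_eq_zero (hφ : IsTest φ) {u : ℝ} (hu : 0 < u) {M : ℕ} (hM : 1 / u ≤ M) {n : ℕ}
    (hn : M ≤ n) : φ ((n + 1 : ℕ) * u) = 0 := by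
  apply hφ.eq_zero_of_one_lt
  have h1 : (1 : ℝ) ≤ M * u := by
    rw [div_le_iff₀ hu] at hM; exact hM
  have h2 : (M : ℝ) * u < (n + 1 : ℕ) * u := by
    apply mul_lt_mul_of_pos_right _ hu
    exact_mod_cast Nat.lt_succ_of_le hn
  linarith

/-- For `u > 0` and `M ≥ 1/u`: `Σ_{n≥1} φ(nu) = Σ_{n<M} φ((n+1)u)`.
[cite: Burnol2001, §2 (before Thm 2.7)] -/
theorem tsum_eq_sum_range (hφ : IsTest φ) {u : ℝ} (hu : 0 < u) {M : ℕ} (hM : 1 / u ≤ M) :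
    ∑' n : ℕ, φ ((n + 1 : ℕ) * u) = ∑ n ∈ Finset.range M, φ ((n + 1 : ℕ) * u) := by
  apply tsum_eq_sum
  intro n hn
  rw [Finset.mem_range, not_lt] at hn
  exact hφ.term_eq_zero hu hM hn

/-- For `u > 1` the periodic sum vanishes. [cite: Burnol2001, §2 (before Thm 2.7)] -/
theorem tsum_eq_zero_of_one_lt (hφ : IsTest φ) {u : ℝ} (hu : 1 < u) :
    ∑' n : ℕ, φ ((n + 1 : ℕ) * u) = 0 := by
  have hu0 : 0 < u := zero_lt_one.trans hu
  have hM : 1 / u ≤ (1 : ℕ) := by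
    rw [Nat.cast_one, div_le_one hu0]; exact hu.le
  rw [hφ.tsum_eq_sum_range hu0 hM, Finset.sum_range_one]
  apply hφ.eq_zero_of_one_lt
  simpa using hu

/-! ## Integrals of a test function -/

/-- A test function is interval-integrable. [cite: Burnol2001, §2 (before Thm 2.7)] -/
theorem intervalIntegrable (hφ : IsTest φ) (a b : ℝ) : IntervalIntegrable φ volume a b :=
  hφ.continuous.intervalIntegrable a b

/-- `∫_0^∞ φ = ∫_0^T φ` for `T ≥ 1`. [cite: Burnol2001, §2 (before Thm 2.7)] -/
theorem integral_Ioi_eq (hφ : IsTest φ) {T : ℝ} (hT : 1 ≤ T) :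
    ∫ x in Ioi (0 : ℝ), φ x = ∫ x in (0 : ℝ)..T, φ x := by
  have hT0 : (0 : ℝ) ≤ T := zero_le_one.trans hT
  have hzero : ∀ x ∈ Ioi T, φ x = 0 := fun x hx ↦ hφ.eq_zero_of_one_lt (lt_of_le_of_lt hT hx)
  rw [intervalIntegral.integral_of_le hT0, ← Ioc_union_Ioi_eq_Ioi hT0,
    setIntegral_union (Set.Ioc_disjoint_Ioi le_rfl) measurableSet_Ioi
      ((hφ.intervalIntegrable 0 T).1) (integrableOn_zero.congr_fun (fun x hx ↦ (hzero x hx).symm)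
        measurableSet_Ioi),
    setIntegral_eq_zero_of_forall_eq_zero hzero, add_zero]

/-! ## The Riemann-sum estimate `|u S(u) − ∫φ| ≤ 2 L u` -/

/-- For `0 < u ≤ 1`: `‖u Σ_{n≥1} φ(nu) − ∫_0^∞ φ‖ ≤ 2 L u`, `L` a Lipschitz constant of `φ` on
`[0, ∞)` (compare the Riemann sum with the integral cell by cell).
[cite: Burnol2001, §2 (before Thm 2.7)] -/
theorem norm_mul_tsum_sub_integral_le (hφ : IsTest φ) {L : ℝ} (hL0 : 0 ≤ L)
    (hL : ∀ x y : ℝ, 0 ≤ x → 0 ≤ y → ‖φ y - φ x‖ ≤ L * |y - x|) {u : ℝ} (hu : 0 < u)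
    (hu1 : u ≤ 1) :
    ‖(u : ℂ) * ∑' n : ℕ, φ ((n + 1 : ℕ) * u) - ∫ x in Ioi (0 : ℝ), φ x‖ ≤ 2 * L * u := by
  set M : ℕ := ⌈1 / u⌉₊ with hMdef
  have hM : 1 / u ≤ M := Nat.le_ceil _
  have hM' : (M : ℝ) ≤ 1 / u + 1 := (Nat.ceil_lt_add_one (div_nonneg zero_le_one hu.le)).le
  have hMu : 1 ≤ (M : ℝ) * u := by rwa [div_le_iff₀ hu] at hM
  rw [hφ.tsum_eq_sum_range hu hM, hφ.integral_Ioi_eq hMu]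
  have hadj := intervalIntegral.sum_integral_adjacent_intervals (μ := volume) (f := φ)
    (a := fun k : ℕ ↦ (k : ℝ) * u) (n := M) (fun k _ ↦ hφ.intervalIntegrable _ _)
  simp only [Nat.cast_zero, zero_mul] at hadj
  rw [← hadj, Finset.mul_sum, ← Finset.sum_sub_distrib]
  have hterm : ∀ n ∈ Finset.range M,
      ‖(u : ℂ) * φ ((n + 1 : ℕ) * u) - ∫ x in ((n : ℕ) : ℝ) * u..((n + 1 : ℕ) : ℝ) * u, φ x‖ ≤
        L * u * u := by
    intro n _
    have hlen : ((n + 1 : ℕ) : ℝ) * u - (n : ℕ) * u = u := by push_cast; ring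
    have hle : ((n : ℕ) : ℝ) * u ≤ ((n + 1 : ℕ) : ℝ) * u := by
      apply mul_le_mul_of_nonneg_right _ hu.le; exact_mod_cast Nat.le_succ n
    have hconst : (u : ℂ) * φ ((n + 1 : ℕ) * u) =
        ∫ _ in ((n : ℕ) : ℝ) * u..((n + 1 : ℕ) : ℝ) * u, φ ((n + 1 : ℕ) * u) := by
      rw [intervalIntegral.integral_const, hlen, Complex.real_smul]
    rw [hconst, ← intervalIntegral.integral_sub intervalIntegrable_const (hφ.intervalIntegrable _ _)]
    have hb := intervalIntegral.norm_integral_le_of_norm_le_const (a := ((n : ℕ) : ℝ) * u)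
      (b := ((n + 1 : ℕ) : ℝ) * u) (C := L * u) (f := fun x ↦ φ ((n + 1 : ℕ) * u) - φ x) ?_
    · rw [hlen, abs_of_pos hu] at hb
      exact hb
    · intro x hx
      rw [Set.uIoc_of_le hle] at hx
      have hx0 : 0 ≤ x := le_trans (mul_nonneg (Nat.cast_nonneg n) hu.le) hx.1.le
      have hy0 : 0 ≤ ((n + 1 : ℕ) : ℝ) * u := mul_nonneg (Nat.cast_nonneg _) hu.le
      calc ‖φ ((n + 1 : ℕ) * u) - φ x‖ ≤ L * |((n + 1 : ℕ) : ℝ) * u - x| := hL x _ hx0 hy0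
        _ ≤ L * u := by
          apply mul_le_mul_of_nonneg_left _ hL0
          rw [abs_of_nonneg (by linarith [hx.2])]
          linarith [hx.1, hlen]
  calc ‖∑ n ∈ Finset.range M, ((u : ℂ) * φ ((n + 1 : ℕ) * u) -
          ∫ x in ((n : ℕ) : ℝ) * u..((n + 1 : ℕ) : ℝ) * u, φ x)‖
      ≤ ∑ n ∈ Finset.range M, L * u * u := norm_sum_le_of_le _ hterm
    _ = M * (L * u * u) := by simp
    _ ≤ (1 / u + 1) * (L * u * u) :=
        mul_le_mul_of_nonneg_right hM' (mul_nonneg (mul_nonneg hL0 hu.le) hu.le)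
    _ = L * u + L * u * u := by field_simp
    _ ≤ 2 * L * u := by nlinarith [mul_le_mul_of_nonneg_left hu1 (mul_nonneg hL0 hu.le)]

/-! ## `E(φ)`: value on `(1,∞)`, bound on `(0,1]`, continuity -/

/-- For `u > 1`: `E(φ)(u) = −(∫_0^∞ φ)/u`. [cite: Burnol2001, §2 (before Thm 2.7)] -/
theorem mapE_eq_of_one_lt (hφ : IsTest φ) {u : ℝ} (hu : 1 < u) :
    mapE φ u = -(∫ x in Ioi (0 : ℝ), φ x) / u := by
  rw [mapE, hφ.tsum_eq_zero_of_one_lt hu]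
  ring

/-- For `0 < u ≤ 1`: `‖E(φ)(u)‖ ≤ 2L` (Burnol: "`E(φ)(u)` is `O(1)` when `u → 0`").
[cite: Burnol2001, §2 (before Thm 2.7)] -/
theorem norm_mapE_le (hφ : IsTest φ) {L : ℝ} (hL0 : 0 ≤ L)
    (hL : ∀ x y : ℝ, 0 ≤ x → 0 ≤ y → ‖φ y - φ x‖ ≤ L * |y - x|) {u : ℝ} (hu : 0 < u)
    (hu1 : u ≤ 1) : ‖mapE φ u‖ ≤ 2 * L := by
  have h := hφ.norm_mul_tsum_sub_integral_le hL0 hL hu hu1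
  have hu' : (u : ℂ) ≠ 0 := by exact_mod_cast hu.ne'
  have e : mapE φ u =
      ((u : ℂ) * ∑' n : ℕ, φ ((n + 1 : ℕ) * u) - ∫ x in Ioi (0 : ℝ), φ x) / u := by
    rw [mapE, sub_div, mul_div_cancel_left₀ _ hu']
  rw [e, norm_div, Complex.norm_real, Real.norm_eq_abs, abs_of_pos hu, div_le_iff₀ hu]
  linarith

/-- `E(φ)` is continuous on `(0, ∞)` (locally a finite sum of continuous functions minus `c/u`).
[cite: Burnol2001, §2 (before Thm 2.7)] -/
theorem continuousOn_mapE (hφ : IsTest φ) : ContinuousOn (mapE φ) (Ioi 0) := by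
  intro u₀ hu₀
  have hu₀' : (0 : ℝ) < u₀ := hu₀
  -- on `Ioi (u₀/2)` the sum is the finite sum over `n < M`, `M = ⌈2/u₀⌉`
  set M : ℕ := ⌈1 / (u₀ / 2)⌉₊ with hM
  have hloc : ∀ u ∈ Ioi (u₀ / 2), mapE φ u =
      ∑ n ∈ Finset.range M, φ ((n + 1 : ℕ) * u) - (∫ x in Ioi (0 : ℝ), φ x) / u := by
    intro u hu
    have hu' : (0 : ℝ) < u := lt_trans (half_pos hu₀') hu
    have hMu : 1 / u ≤ M := by
      refine le_trans ?_ (Nat.le_ceil _)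
      exact one_div_le_one_div_of_le (half_pos hu₀') (le_of_lt hu)
    rw [mapE, hφ.tsum_eq_sum_range hu' hMu]
  have hcont : ContinuousOn
      (fun u : ℝ ↦ ∑ n ∈ Finset.range M, φ ((n + 1 : ℕ) * u) - (∫ x in Ioi (0 : ℝ), φ x) / u)
      (Ioi (u₀ / 2)) := by
    apply ContinuousOn.sub
    · exact (continuous_finsetSum _ fun n _ ↦
        hφ.continuous.comp (continuous_const.mul continuous_id)).continuousOn
    · apply ContinuousOn.div continuousOn_const Complex.continuous_ofReal.continuousOn
      intro x hx
      exact_mod_cast (lt_trans (half_pos hu₀') hx : (0 : ℝ) < x).ne'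
  have hmem : Ioi (u₀ / 2) ∈ 𝓝 u₀ := Ioi_mem_nhds (by linarith)
  have key : ContinuousAt (mapE φ) u₀ := by
    have h1 : ContinuousAt (fun u : ℝ ↦ ∑ n ∈ Finset.range M, φ ((n + 1 : ℕ) * u) -
        (∫ x in Ioi (0 : ℝ), φ x) / u) u₀ := hcont.continuousAt hmem
    refine h1.congr ?_
    filter_upwards [hmem] with u hu using (hloc u hu).symm
  exact key.continuousWithinAt

/-- `v ↦ E(φ)(v)/v` is continuous on `(0, ∞)`. [cite: Burnol2001, §2 (before Thm 2.7)] -/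
theorem continuousOn_mapE_div (hφ : IsTest φ) :
    ContinuousOn (fun v : ℝ ↦ mapE φ v / v) (Ioi 0) := by
  refine hφ.continuousOn_mapE.div Complex.continuous_ofReal.continuousOn fun x hx ↦ ?_
  exact_mod_cast (hx : (0 : ℝ) < x).ne'

/-- `v ↦ E(φ)(v)/v` is integrable on `(u, 1]` for `u > 0`. [cite: Burnol2001, §2 (before Thm 2.7)] -/
theorem integrableOn_mapE_div_Ioc (hφ : IsTest φ) {u : ℝ} (hu : 0 < u) :
    IntegrableOn (fun v : ℝ ↦ mapE φ v / v) (Ioc u 1) := by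
  have h : ContinuousOn (fun v : ℝ ↦ mapE φ v / v) (Icc u 1) :=
    hφ.continuousOn_mapE_div.mono fun x hx ↦ lt_of_lt_of_le hu hx.1
  exact (h.integrableOn_Icc).mono_set Ioc_subset_Icc_self

/-- On `(1, ∞)`: `E(φ)(v)/v = −c · v^{−2}`. [cite: Burnol2001, §2 (before Thm 2.7)] -/
theorem mapE_div_eq_of_one_lt (hφ : IsTest φ) {v : ℝ} (hv : 1 < v) :
    mapE φ v / v = -(∫ x in Ioi (0 : ℝ), φ x) * ((v ^ (-2 : ℝ) : ℝ) : ℂ) := by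
  have hv0 : (0 : ℝ) < v := zero_lt_one.trans hv
  have hv' : (v : ℂ) ≠ 0 := by exact_mod_cast hv0.ne'
  rw [hφ.mapE_eq_of_one_lt hv, Real.rpow_neg hv0.le, show (2 : ℝ) = (2 : ℕ) by norm_num,
    Real.rpow_natCast]
  push_cast
  field_simp

/-- `v ↦ E(φ)(v)/v` is integrable on `(a, ∞)` for `a ≥ 1`. [cite: Burnol2001, §2 (before Thm 2.7)] -/
theorem integrableOn_mapE_div_Ioi (hφ : IsTest φ) {a : ℝ} (ha : 1 ≤ a) :
    IntegrableOn (fun v : ℝ ↦ mapE φ v / v) (Ioi a) := by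
  have ha0 : 0 < a := zero_lt_one.trans_le ha
  have hint : IntegrableOn (fun v : ℝ ↦ -(∫ x in Ioi (0 : ℝ), φ x) * ((v ^ (-2 : ℝ) : ℝ) : ℂ))
      (Ioi a) :=
    ((integrableOn_Ioi_rpow_of_lt (by norm_num) ha0).ofReal).const_mul _
  refine hint.congr_fun (fun v hv ↦ ?_) measurableSet_Ioi
  exact (hφ.mapE_div_eq_of_one_lt (lt_of_le_of_lt ha hv)).symm

/-- For `a ≥ 1`: `∫_a^∞ E(φ)(v) dv/v = −c/a` (`c = ∫_0^∞ φ`). [cite: Burnol2001, §2 (before Thm 2.7)] -/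
theorem integral_mapE_div_Ioi (hφ : IsTest φ) {a : ℝ} (ha : 1 ≤ a) :
    ∫ v in Ioi a, mapE φ v / v = -(∫ x in Ioi (0 : ℝ), φ x) / a := by
  have ha0 : 0 < a := zero_lt_one.trans_le ha
  rw [setIntegral_congr_fun measurableSet_Ioi
    (fun v hv ↦ hφ.mapE_div_eq_of_one_lt (lt_of_le_of_lt ha hv)), MeasureTheory.integral_const_mul,
    integral_complex_ofReal, integral_Ioi_rpow_of_lt (by norm_num) ha0]
  have : -a ^ ((-2 : ℝ) + 1) / ((-2 : ℝ) + 1) = a⁻¹ := by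
    rw [show (-2 : ℝ) + 1 = -1 by norm_num, Real.rpow_neg_one]; ring
  rw [this]
  push_cast
  field_simp

/-- `v ↦ E(φ)(v)/v` is integrable on `(u, ∞)` for `0 < u`. [cite: Burnol2001, §2 (before Thm 2.7)] -/
theorem integrableOn_mapE_div (hφ : IsTest φ) {u : ℝ} (hu : 0 < u) :
    IntegrableOn (fun v : ℝ ↦ mapE φ v / v) (Ioi u) := by
  by_cases hu1 : u ≤ 1
  · rw [← Ioc_union_Ioi_eq_Ioi hu1]
    exact (hφ.integrableOn_mapE_div_Ioc hu).union (hφ.integrableOn_mapE_div_Ioi le_rfl)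
  · exact hφ.integrableOn_mapE_div_Ioi (not_le.1 hu1).le

/-! ## `V E(φ)`: support in `(0,1]` and the bound on `(0,1]` -/

/-- **Support:** `V E(φ)(u) = 0` for `u > 1` ("`VE(φ)` has support in `(0,1]`").
[cite: Burnol2001, §2 (before Thm 2.7)] -/
theorem opV_mapE_eq_zero (hφ : IsTest φ) {u : ℝ} (hu : 1 < u) : opV (mapE φ) u = 0 := by
  rw [opV, hφ.integral_mapE_div_Ioi hu.le, hφ.mapE_eq_of_one_lt hu]
  ring

/-- `∫_u^1 dv/v`-bound: `‖∫_{(u,1]} E(φ)(v) dv/v‖ ≤ 2L · (−log u)` for `0 < u ≤ 1`.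
[cite: Burnol2001, §2 (before Thm 2.7)] -/
theorem norm_integral_mapE_div_Ioc_le (hφ : IsTest φ) {L : ℝ} (hL0 : 0 ≤ L)
    (hL : ∀ x y : ℝ, 0 ≤ x → 0 ≤ y → ‖φ y - φ x‖ ≤ L * |y - x|) {u : ℝ} (hu : 0 < u)
    (hu1 : u ≤ 1) : ‖∫ v in Ioc u 1, mapE φ v / v‖ ≤ 2 * L * -Real.log u := by
  have hbound : ∀ v ∈ Ioc u 1, ‖mapE φ v / v‖ ≤ 2 * L * v⁻¹ := by
    intro v hv
    have hv0 : 0 < v := lt_trans hu hv.1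
    rw [norm_div, Complex.norm_real, Real.norm_eq_abs, abs_of_pos hv0, div_eq_mul_inv]
    exact mul_le_mul_of_nonneg_right (hφ.norm_mapE_le hL0 hL hv0 hv.2) (inv_nonneg.2 hv0.le)
  have hint : IntegrableOn (fun v : ℝ ↦ 2 * L * v⁻¹) (Ioc u 1) := by
    refine ((continuousOn_const.mul (continuousOn_inv₀.mono ?_)).integrableOn_Icc).mono_set
      Ioc_subset_Icc_self
    intro x hx
    exact (lt_of_lt_of_le hu hx.1).ne'
  calc ‖∫ v in Ioc u 1, mapE φ v / v‖
      ≤ ∫ v in Ioc u 1, ‖mapE φ v / v‖ := norm_integral_le_integral_norm _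
    _ ≤ ∫ v in Ioc u 1, 2 * L * v⁻¹ :=
        setIntegral_mono_on (hφ.integrableOn_mapE_div_Ioc hu).norm hint measurableSet_Ioc hbound
    _ = 2 * L * -Real.log u := by
        rw [← intervalIntegral.integral_of_le hu1, intervalIntegral.integral_const_mul,
          integral_inv (by
            rw [Set.uIcc_of_le hu1]; exact fun h ↦ (lt_irrefl (0 : ℝ)) (lt_of_lt_of_le hu h.1)),
          one_div, Real.log_inv]

/-- **Bound on `(0,1]`:** `‖V E(φ)(u)‖ ≤ 2L + 2L(−log u) + ‖c‖`.
[cite: Burnol2001, §2 (before Thm 2.7)] -/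
theorem norm_opV_mapE_le (hφ : IsTest φ) {L : ℝ} (hL0 : 0 ≤ L)
    (hL : ∀ x y : ℝ, 0 ≤ x → 0 ≤ y → ‖φ y - φ x‖ ≤ L * |y - x|) {u : ℝ} (hu : 0 < u)
    (hu1 : u ≤ 1) :
    ‖opV (mapE φ) u‖ ≤ 2 * L + 2 * L * -Real.log u + ‖∫ x in Ioi (0 : ℝ), φ x‖ := by
  have hsplit : ∫ v in Ioi u, mapE φ v / v =
      (∫ v in Ioc u 1, mapE φ v / v) + ∫ v in Ioi 1, mapE φ v / v := by
    rw [← Ioc_union_Ioi_eq_Ioi hu1]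
    exact setIntegral_union (Set.Ioc_disjoint_Ioi le_rfl) measurableSet_Ioi
      (hφ.integrableOn_mapE_div_Ioc hu) (hφ.integrableOn_mapE_div_Ioi le_rfl)
  rw [opV, hsplit, hφ.integral_mapE_div_Ioi le_rfl]
  have h1 := hφ.norm_mapE_le hL0 hL hu hu1
  have h2 := hφ.norm_integral_mapE_div_Ioc_le hL0 hL hu hu1
  calc ‖mapE φ u - ((∫ v in Ioc u 1, mapE φ v / v) + -(∫ x in Ioi (0 : ℝ), φ x) / ((1 : ℝ) : ℂ))‖
      ≤ ‖mapE φ u‖ + (‖∫ v in Ioc u 1, mapE φ v / v‖ + ‖-(∫ x in Ioi (0 : ℝ), φ x) / ((1 : ℝ) : ℂ)‖) :=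
        (norm_sub_le _ _).trans (add_le_add le_rfl (norm_add_le _ _))
    _ ≤ 2 * L + (2 * L * -Real.log u + ‖∫ x in Ioi (0 : ℝ), φ x‖) := by
        gcongr
        simp
    _ = 2 * L + 2 * L * -Real.log u + ‖∫ x in Ioi (0 : ℝ), φ x‖ := by ring

/-! ## Measurability and square-integrability -/

/-- `V E(φ)` is continuous on `(0, 1)`. [cite: Burnol2001, §2 (before Thm 2.7)] -/
theorem continuousOn_opV_mapE (hφ : IsTest φ) : ContinuousOn (opV (mapE φ)) (Ioo 0 1) := by
  -- on `(0,1)`: `V E(φ)(u) = E(φ)(u) − (−∫_1^u g + ∫_1^∞ g)`, `g(v) = E(φ)(v)/v`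
  have hrepr : ∀ u ∈ Ioo (0 : ℝ) 1,
      opV (mapE φ) u = mapE φ u -
        (-(∫ v in (1 : ℝ)..u, mapE φ v / v) + ∫ v in Ioi (1 : ℝ), mapE φ v / v) := by
    intro u hu
    have hsplit : ∫ v in Ioi u, mapE φ v / v =
        (∫ v in Ioc u 1, mapE φ v / v) + ∫ v in Ioi 1, mapE φ v / v := by
      rw [← Ioc_union_Ioi_eq_Ioi hu.2.le]
      exact setIntegral_union (Set.Ioc_disjoint_Ioi le_rfl) measurableSet_Ioi
        (hφ.integrableOn_mapE_div_Ioc hu.1) (hφ.integrableOn_mapE_div_Ioi le_rfl)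
    rw [opV, hsplit, intervalIntegral.integral_symm, neg_neg,
      intervalIntegral.integral_of_le hu.2.le]
  intro u₀ hu₀
  have ha : 0 < u₀ / 2 := by linarith [hu₀.1]
  have hle : u₀ / 2 ≤ 1 := by linarith [hu₀.2]
  have hcg : ContinuousOn (fun v : ℝ ↦ mapE φ v / v) (Icc (u₀ / 2) 1) :=
    hφ.continuousOn_mapE_div.mono fun x hx ↦ lt_of_lt_of_le ha hx.1
  have hint : IntervalIntegrable (fun v : ℝ ↦ mapE φ v / v) volume (u₀ / 2) 1 :=
    hcg.intervalIntegrable_of_Icc hle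
  have hprim : ContinuousOn (fun b ↦ ∫ v in (1 : ℝ)..b, mapE φ v / v) (Set.uIcc (u₀ / 2) 1) :=
    intervalIntegral.continuousOn_primitive_interval' hint (by
      rw [Set.uIcc_of_le hle]; exact ⟨hle, le_rfl⟩)
  rw [Set.uIcc_of_le hle] at hprim
  have hmem : Icc (u₀ / 2) 1 ∈ 𝓝 u₀ := Icc_mem_nhds (by linarith [hu₀.1]) hu₀.2
  have h1 : ContinuousAt (fun b ↦ ∫ v in (1 : ℝ)..b, mapE φ v / v) u₀ := hprim.continuousAt hmem
  have h2 : ContinuousAt (mapE φ) u₀ := hφ.continuousOn_mapE.continuousAt (Ioi_mem_nhds hu₀.1)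
  have h3 : ContinuousAt (fun u ↦ mapE φ u -
      (-(∫ v in (1 : ℝ)..u, mapE φ v / v) + ∫ v in Ioi (1 : ℝ), mapE φ v / v)) u₀ :=
    h2.sub (h1.neg.add continuousAt_const)
  refine (h3.congr ?_).continuousWithinAt
  filter_upwards [Ioo_mem_nhds hu₀.1 hu₀.2] with u hu using (hrepr u hu).symm

/-- `V E(φ)` is a.e.-strongly measurable on `(0, ∞)`. [cite: Burnol2001, §2 (before Thm 2.7)] -/
theorem aestronglyMeasurable_opV_mapE (hφ : IsTest φ) :
    AEStronglyMeasurable (opV (mapE φ)) (volume.restrict (Ioi (0 : ℝ))) := by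
  rw [← Ioc_union_Ioi_eq_Ioi zero_le_one, aestronglyMeasurable_union_iff]
  constructor
  · rw [← Measure.restrict_congr_set Ioo_ae_eq_Ioc]
    exact hφ.continuousOn_opV_mapE.aestronglyMeasurable measurableSet_Ioo
  · refine (aestronglyMeasurable_const (b := (0 : ℂ))).congr ?_
    filter_upwards [ae_restrict_mem measurableSet_Ioi] with u hu
    exact (hφ.opV_mapE_eq_zero hu).symm

/-- **Square-integrability:** `V E(φ) ∈ L²((0,∞), du)` (dominated on `(0,1]` by
`D · u^{−1/4}`, zero on `(1,∞)`). [cite: Burnol2001, §2 (before Thm 2.7)] -/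
theorem memLp_opV_mapE (hφ : IsTest φ) :
    MemLp (opV (mapE φ)) 2 (volume.restrict (Ioi (0 : ℝ))) := by
  obtain ⟨L, hL0, hL⟩ := hφ.exists_lipschitz
  set c : ℂ := ∫ x in Ioi (0 : ℝ), φ x with hc
  set D : ℝ := 2 * L + ‖c‖ + 8 * L with hD
  set g₀ : ℝ → ℝ := (Ioc (0 : ℝ) 1).indicator fun u ↦ D * u ^ (-(1 / 4 : ℝ)) with hg₀
  have hg₀_meas : AEStronglyMeasurable g₀ (volume.restrict (Ioi (0 : ℝ))) := by
    apply Measurable.aestronglyMeasurable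
    exact (measurable_const.mul (measurable_id.pow_const _)).indicator measurableSet_Ioc
  have hg₀_mem : MemLp g₀ 2 (volume.restrict (Ioi (0 : ℝ))) := by
    rw [memLp_two_iff_integrable_sq hg₀_meas]
    have hsq : (fun u ↦ g₀ u ^ 2) =
        (Ioc (0 : ℝ) 1).indicator fun u ↦ D ^ 2 * u ^ (-(1 / 2 : ℝ)) := by
      funext u
      by_cases hu : u ∈ Ioc (0 : ℝ) 1
      · have e : (u ^ (-(1 / 4 : ℝ))) ^ 2 = u ^ (-(1 / 2 : ℝ)) := by
          rw [← Real.rpow_two, ← Real.rpow_mul hu.1.le]; norm_num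
        rw [hg₀, Set.indicator_of_mem hu, Set.indicator_of_mem hu, mul_pow, e]
      · rw [hg₀, Set.indicator_of_notMem hu, Set.indicator_of_notMem hu]
        norm_num
    rw [hsq]
    apply Integrable.mono_measure _ Measure.restrict_le_self
    rw [integrable_indicator_iff measurableSet_Ioc]
    have h := intervalIntegral.intervalIntegrable_rpow' (r := -(1 / 2 : ℝ)) (by norm_num)
      (a := 0) (b := 1)
    rw [intervalIntegrable_iff_integrableOn_Ioc_of_le zero_le_one] at h
    exact h.const_mul _
  refine MemLp.of_le hg₀_mem hφ.aestronglyMeasurable_opV_mapE ?_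
  filter_upwards [ae_restrict_mem measurableSet_Ioi] with u hu
  have hu0 : (0 : ℝ) < u := hu
  by_cases hu1 : u ≤ 1
  · have hmem : u ∈ Ioc (0 : ℝ) 1 := ⟨hu0, hu1⟩
    have hupos : 0 < u ^ (-(1 / 4 : ℝ)) := Real.rpow_pos_of_pos hu0 _
    have hc0 : 0 ≤ ‖c‖ := norm_nonneg _
    have hD0 : 0 ≤ D := by rw [hD]; linarith
    rw [hg₀, Set.indicator_of_mem hmem, Real.norm_eq_abs, abs_of_nonneg (mul_nonneg hD0 hupos.le)]
    have hb := hφ.norm_opV_mapE_le hL0 hL hu0 hu1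
    have hlog : -Real.log u ≤ 4 * u ^ (-(1 / 4 : ℝ)) := by
      have h := Real.abs_log_mul_self_rpow_lt u (1 / 4) hu0 hu1 (by norm_num)
      have hprod : u ^ (1 / 4 : ℝ) * u ^ (-(1 / 4 : ℝ)) = 1 := by
        rw [← Real.rpow_add hu0]; norm_num
      have h' : -Real.log u * u ^ (1 / 4 : ℝ) ≤ 4 := by
        have h1 := (abs_lt.1 h).1
        norm_num at h1 ⊢
        linarith
      calc -Real.log u = (-Real.log u * u ^ (1 / 4 : ℝ)) * u ^ (-(1 / 4 : ℝ)) := by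
            rw [mul_assoc, hprod, mul_one]
        _ ≤ 4 * u ^ (-(1 / 4 : ℝ)) := mul_le_mul_of_nonneg_right h' hupos.le
    have hone : (1 : ℝ) ≤ u ^ (-(1 / 4 : ℝ)) :=
      Real.one_le_rpow_of_pos_of_le_one_of_nonpos hu0 hu1 (by norm_num)
    calc ‖opV (mapE φ) u‖ ≤ 2 * L + 2 * L * -Real.log u + ‖c‖ := hb
      _ ≤ (2 * L + ‖c‖) * u ^ (-(1 / 4 : ℝ)) + 2 * L * (4 * u ^ (-(1 / 4 : ℝ))) := by
          have i1 := mul_le_mul_of_nonneg_left hlog (by linarith : (0 : ℝ) ≤ 2 * L)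
          have i2 := mul_le_mul_of_nonneg_left hone (by linarith : (0 : ℝ) ≤ 2 * L + ‖c‖)
          linarith
      _ = D * u ^ (-(1 / 4 : ℝ)) := by rw [hD]; ring
  · have hu1' : 1 < u := lt_of_not_ge hu1
    rw [hφ.opV_mapE_eq_zero hu1', norm_zero]
    exact norm_nonneg _

end IsTest

end Burnol2001

open Burnol2001 in
/-- **Burnol 2001, Thm 2.7 (inclusion clause)** (discharge of `Burnol2001_thm_2_7_subset`): for
every smooth even `φ` supported in `[−1,1]`, `V E(φ)` is square-integrable on `(0,∞)` and vanishes
on `(1,∞)`, i.e. `V E(φ) ∈ ℍ²`. [cite: Burnol2001, Thm 2.7 (arXiv v3)] -/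
theorem Burnol2001_thm_2_7_subset_holds : Burnol2001_thm_2_7_subset := by
  intro φ hφ
  refine ⟨hφ.memLp_opV_mapE, ?_⟩
  filter_upwards [ae_restrict_mem measurableSet_Ioi] with u hu
  exact hφ.opV_mapE_eq_zero hu

end Literature.NumberTheory.LFunctions
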